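import Summits.ResolutionOfSingularities.ResolutionOfSingularities.Theorems.MarkedTransferCampaignW46CuspStaircaseProof
import Mathlib.AlgebraicGeometry.Morphisms.Finite
import HarnessLib

/-!
# [OURS · L1 W4.6, rung (iii)] The cusp staircase, VIII — the singular point over the centre is a CLOSED point
# (cell res-hironaka, LADDER-RESOLUTION rung L, D-0089; slot W4.6, seat res-L1-s46-pv-5 gen 3; host route MarkedTransfer,
# `--kind proof --supports stmt-ResolutionOfSingularities-16155 --as helper`)

HONEST FRAMING. Everything here is OURS and elementary: commutative algebra of the chart ring of a point blow-up
(tree `Literature.AlgebraicGeometry.Resolution.BlowupChartRsop` / `BlowupChartQuasiRegular` / `BlowupStalkCharts`) and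
Mathlib's Jacobson-scheme criterion for closed points (Stacks 01TB). NOTHING here is a statement of H. Hironaka's
manuscript *Resolution of singularities in positive characteristics* (2017-03-23, [Hironaka2017]) and nothing here asserts
that any statement of it holds. No FACT-LIST premise is used. AI review is weaker than expert review. No `sorry`; axioms
standard.

## Why this file

The rungs of this seat (`CampaignW46.Regime.mohWindowCurve`, `Regime.cuspCurve`: files `…MohWindow*.lean`,
`…CuspStaircase*.lean`) impose the regime on the state of the typed Th. 16.6 procedure AT EVERY STAGE (DESIGN POINT
(REG) of `…TypedProcedure.lean`), and one clause of the regime is «`Sing(E)` consists of CLOSED points». To discharge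
(REG) from the INPUT alone (companion `…CuspStaircasePropagation.lean`: the regimes are stable under every typed step) one
must know that the unique singular point `x′` of the transform over the blown-up closed point `ξ` — the origin of the
chart `t = x` (`Cusp.cuspShape_transform_of_le`) — is again a closed point of `Z′`. This file proves it:

* `Cusp.exists_sub_chartBase_mem` — at a prime `𝔴` of the chart ring `B = R[𝔪/c_j]` containing all chart generators
  `e_i = c_i/c_j` (`i ≠ j`), every element of `B` is congruent modulo `𝔴` to a constant from `R` (`B` is generated by the
  `e_i`, tree `eval₂Hom_chartGen_surjective`).
* `Cusp.residueField_map_surjective_of_chartOrigin` — hence for a local ring `L = B_𝔴` (`𝔴 ∩ R = 𝔪_R`) the residue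
  field map `κ(R) → κ(L)` is surjective.
* `Cusp.isClosed_singleton_of_residueFieldMap_surjective` — Mathlib packaging (Stacks 01TB): for `π : X′ → X` locally of
  finite type, `X` Jacobson, a point `x′` over a CLOSED point with SURJECTIVE residue field map `κ(π x′) → κ(x′)` is closed
  (`isClosed_singleton_iff_locallyOfFiniteType`, `locallyOfFiniteType_of_comp`).
* `Cusp.residueFieldMap_surjective_of_le`, `Cusp.isClosed_singleton_of_le` — for the point blow-up of a cusp germ
  `J_ξ = (y^b + u·x^d)`, `1 ≤ b < d`, every point `x′` over `ξ` with `ord_{x′} J′ ≥ b` has surjective residue field map,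
  hence is closed when `ξ` is (the chart analysis of `Cusp.cuspShape_transform_of_le` re-run to expose the chart origin).

## References

* The Stacks Project, Tags 0804, 052P (affine blow-up algebra generated by the `x/f`), 01TB (closed points of schemes
  locally of finite type over a Jacobson scheme). [cite: StacksProject, Tag 01TB]
* This seat: `…CuspStaircaseProof.lean` (p482582), `…MohWindowProof.lean` (p473117); RUNG-MAP-W46.md §RUNG (iii) (res-L1-type-o1).
* H. Hironaka, ms. 2017-03-23, §2 p.4 l.34 («`Y_cl`»), Th. 16.6 p.84 l.4–20 — scope only, under adjudication, not cited as
  fact. [Hironaka2017]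
-/

noncomputable section

set_option linter.dupNamespace false -- mandated namespace of this single-conjunct summit

open CategoryTheory AlgebraicGeometry TopologicalSpace IsLocalRing

namespace Summit.ResolutionOfSingularities.ResolutionOfSingularities.Theorems

namespace CampaignW46

open Literature.AlgebraicGeometry.Resolution
open Literature.AlgebraicGeometry.Hironaka2017.S02Preliminaries
open Literature.AlgebraicGeometry.Hironaka2017.Datum
open Scheme.IdealSheafData

namespace Cusp

universe u

/-! ## The chart ring at its origin: constants represent everything -/

section ChartAlgebra

variable {R : Type u} [CommRing R] {n : ℕ} (c : Fin n → R) (j : Fin n)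

/-- **At the origin of the chart every element of the chart ring is a constant modulo `𝔴`.** For the chart ring
`B = (R[It])_{(c_j t)}` of the blow-up of `I = (c_0, …, c_{n−1})` and an ideal `𝔴 ⊆ B` containing every chart generator
`e_i = (c_i t)/(c_j t)`, `i ≠ j`: every `w ∈ B` satisfies `w − φ(r) ∈ 𝔴` for some `r ∈ R` (`φ = chartBase`), because `B`
is generated over `φ(R)` by the `e_i` (tree `eval₂Hom_chartGen_surjective`) and a polynomial is its constant term modulo
the variables. [cite: StacksProject, Tag 052P] -/
theorem exists_sub_chartBase_mem (𝔴 : Ideal (chartRing c j)) (horig : ∀ i, i ≠ j → chartGen c j i ∈ 𝔴)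
    (w : chartRing c j) : ∃ r : R, w - chartBase c j r ∈ 𝔴 := by
  obtain ⟨P, rfl⟩ := eval₂Hom_chartGen_surjective c j w
  refine ⟨MvPolynomial.constantCoeff P, ?_⟩
  change (MvPolynomial.eval₂Hom (chartBase c j) (fun i : {i : Fin n // i ≠ j} => chartGen c j i.1)) P -
    chartBase c j (MvPolynomial.constantCoeff P) ∈ 𝔴
  induction P using MvPolynomial.induction_on with
  | C a =>
    have h : (MvPolynomial.eval₂Hom (chartBase c j) (fun i : {i : Fin n // i ≠ j} => chartGen c j i.1))
        (MvPolynomial.C a : MvPolynomial {i : Fin n // i ≠ j} R) -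
        chartBase c j (MvPolynomial.constantCoeff (MvPolynomial.C a : MvPolynomial {i : Fin n // i ≠ j} R)) = 0 := by
      rw [MvPolynomial.coe_eval₂Hom, MvPolynomial.eval₂_C, MvPolynomial.constantCoeff_C]
      abel
    rw [h]
    exact zero_mem _
  | add p q hp hq =>
    have h : (MvPolynomial.eval₂Hom (chartBase c j) (fun i : {i : Fin n // i ≠ j} => chartGen c j i.1)) (p + q) -
        chartBase c j (MvPolynomial.constantCoeff (p + q)) =
        ((MvPolynomial.eval₂Hom (chartBase c j) (fun i : {i : Fin n // i ≠ j} => chartGen c j i.1)) p -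
          chartBase c j (MvPolynomial.constantCoeff p)) +
        ((MvPolynomial.eval₂Hom (chartBase c j) (fun i : {i : Fin n // i ≠ j} => chartGen c j i.1)) q -
          chartBase c j (MvPolynomial.constantCoeff q)) := by
      rw [map_add, map_add, map_add]
      ring
    rw [h]
    exact add_mem hp hq
  | mul_X p i hp =>
    have h : (MvPolynomial.eval₂Hom (chartBase c j) (fun i : {i : Fin n // i ≠ j} => chartGen c j i.1)) (p * MvPolynomial.X i) -
        chartBase c j (MvPolynomial.constantCoeff (p * MvPolynomial.X i)) =
        (MvPolynomial.eval₂Hom (chartBase c j) (fun i : {i : Fin n // i ≠ j} => chartGen c j i.1)) p *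
          chartGen c j i.1 := by
      rw [map_mul, map_mul, MvPolynomial.constantCoeff_X, mul_zero, map_zero, MvPolynomial.coe_eval₂Hom,
        MvPolynomial.eval₂_X]
      abel
    rw [h]
    exact Ideal.mul_mem_left _ _ (horig i.1 i.2)

/-- **At the origin of the chart the residue field does not grow.** Let `R` be local, `𝔴` a prime of the chart ring
`B = (R[It])_{(c_j t)}` lying over `𝔪_R` and containing every chart generator `e_i`, `i ≠ j`, and `L` a local ring that
is a localisation of `B` at `𝔴`, with `ψ : R → L` the composite structure map (a local homomorphism). Then the residue
field map `κ(R) → κ(L)` is surjective: `w/s ∈ L` has the same residue as `ψ(r_w)/ψ(r_s)` where `w ≡ φ(r_w)`,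
`s ≡ φ(r_s)` modulo `𝔴` (`exists_sub_chartBase_mem`; `r_s` is a unit as `s ∉ 𝔴 ⊇ φ(𝔪_R)`). [cite: StacksProject, Tag 052P] -/
theorem residueField_map_surjective_of_chartOrigin [IsLocalRing R] {L : Type u} [CommRing L] [IsLocalRing L]
    (𝔴 : Ideal (chartRing c j)) [𝔴.IsPrime] (h𝔴 : 𝔴.comap (chartBase c j) = maximalIdeal R)
    (horig : ∀ i, i ≠ j → chartGen c j i ∈ 𝔴) [Algebra (chartRing c j) L] [IsLocalization.AtPrime L 𝔴]
    (ψ : R →+* L) [IsLocalHom ψ]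
    (hψ : ∀ a, (algebraMap (chartRing c j) L : chartRing c j →+* L) (chartBase c j a) = ψ a) :
    Function.Surjective (IsLocalRing.ResidueField.map ψ) := by
  intro z
  obtain ⟨l, rfl⟩ := IsLocalRing.residue_surjective z
  obtain ⟨⟨w, s⟩, rfl⟩ := IsLocalization.mk'_surjective 𝔴.primeCompl l
  obtain ⟨rw, hrw⟩ := exists_sub_chartBase_mem c j 𝔴 horig w
  obtain ⟨rs, hrs⟩ := exists_sub_chartBase_mem c j 𝔴 horig (s : chartRing c j)
  -- abbreviation for the structure map `B → L`
  obtain ⟨a, ha⟩ : ∃ a : chartRing c j →+* L, a = algebraMap (chartRing c j) L := ⟨_, rfl⟩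
  have hmem : ∀ v : chartRing c j, v ∈ 𝔴 → a v ∈ maximalIdeal L := fun v hv => by
    rw [ha]; exact (IsLocalization.AtPrime.to_map_mem_maximal_iff L 𝔴 v).mpr hv
  -- `r_s` is a unit of `R`
  have hrsm : rs ∉ maximalIdeal R := by
    intro h
    rw [← h𝔴, Ideal.mem_comap] at h
    have hs : (s : chartRing c j) ∈ 𝔴 := by
      convert 𝔴.add_mem hrs h using 1
      ring
    exact s.2 hs
  have hψs : residue L (ψ rs) ≠ 0 := by
    rw [Ne, IsLocalRing.residue_eq_zero_iff]
    intro h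
    apply hrsm
    have hu : ¬ IsUnit (ψ rs) := fun hu => (IsLocalRing.mem_maximalIdeal _).mp h hu
    exact (IsLocalRing.mem_maximalIdeal _).mpr fun hu' => hu (hu'.map ψ)
  have hRs : residue R rs ≠ 0 := by
    rw [Ne, IsLocalRing.residue_eq_zero_iff]; exact hrsm
  -- residues of `a w`, `a s` are those of `ψ r_w`, `ψ r_s`
  have hres : ∀ (v : chartRing c j) (r : R), v - chartBase c j r ∈ 𝔴 → residue L (a v) = residue L (ψ r) := by
    intro v r hv
    rw [← sub_eq_zero, ← map_sub, IsLocalRing.residue_eq_zero_iff, ← hψ, ← ha, ← map_sub]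
    exact hmem _ hv
  refine ⟨residue R rw * (residue R rs)⁻¹, ?_⟩
  rw [map_mul, map_inv₀, IsLocalRing.ResidueField.map_residue, IsLocalRing.ResidueField.map_residue,
    ← hres w rw hrw, ← hres (s : chartRing c j) rs hrs, eq_comm, eq_mul_inv_iff_mul_eq₀ ((hres _ rs hrs) ▸ hψs),
    ← map_mul, ha, IsLocalization.mk'_spec]

end ChartAlgebra

/-! ## Closed points over closed points (Stacks 01TB, packaged) -/

section Jacobson

/-- **A point over a closed point with no residue field extension is closed.** For a morphism `π : X′ → X` locally of
finite type with `X` Jacobson (e.g. locally of finite type over a field), a point `x′ ∈ X′` such that `{π x′}` is closed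
and the residue field map `κ(π x′) → κ(x′)` is surjective: `{x′}` is closed. Proof: `X′` is Jacobson; by Stacks 01TB a
point of a Jacobson scheme is closed iff `Spec κ(x) → X` is locally of finite type; `Spec κ(x′) → Spec κ(π x′)` is a
closed immersion, so `Spec κ(x′) → X′ → X` is locally of finite type, and so is `Spec κ(x′) → X′` by cancellation.
[cite: StacksProject, Tag 01TB] -/
theorem isClosed_singleton_of_residueFieldMap_surjective {X X' : Scheme.{u}} (π : X' ⟶ X)
    [LocallyOfFiniteType π] [JacobsonSpace X] {x' : X'} (hcl : IsClosed ({π.base x'} : Set X))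
    (hsurj : Function.Surjective (π.residueFieldMap x')) : IsClosed ({x'} : Set X') := by
  haveI : JacobsonSpace X' := LocallyOfFiniteType.jacobsonSpace π
  haveI : LocallyOfFiniteType (X.fromSpecResidueField (π.base x')) :=
    isClosed_singleton_iff_locallyOfFiniteType.mp hcl
  haveI : IsClosedImmersion (Spec.map (π.residueFieldMap x')) :=
    IsClosedImmersion.spec_of_surjective _ hsurj
  haveI : LocallyOfFiniteType (X'.fromSpecResidueField x' ≫ π) := by
    rw [← Scheme.Hom.SpecMap_residueFieldMap_fromSpecResidueField]
    infer_instance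
  haveI := locallyOfFiniteType_of_comp (X'.fromSpecResidueField x') π
  exact isClosed_singleton_iff_locallyOfFiniteType.mpr this

end Jacobson

/-! ## The point blow-up of a cusp germ: the singular point over the centre -/

section Local

variable {X X' : Scheme.{u}} {π : X' ⟶ X}

/-- **Residue fields do not grow at the singular point over a blown-up cusp point.** Let `π : X′ → X` be a blow-up along
the ideal of a closed `Y` with `𝓘_{Y,π x′} = 𝔪_{π x′}`, and `J_{π x′} = (y^b + u·x^d)` a cusp germ (`CuspShape b d`),
`1 ≤ b < d`. If `ord_{x′} J′ ≥ b` for the controlled transform `J′ = (J𝒪_{X′} : 𝓘_E^b)`, then `x′` is the origin of the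
chart `t = x` (as in `Cusp.cuspShape_transform_of_le`: in the chart `t = y`, and off the origin of the chart `t = x`,
`J′_{x′}` is the unit ideal), so the residue field map `κ(π x′) → κ(x′)` is surjective
(`residueField_map_surjective_of_chartOrigin`). [cite: StacksProject, Tag 0804] -/
theorem residueField_map_stalkMap_surjective_of_le [IsLocallyNoetherian X'] {Y : Closeds X}
    (hπ : IsBlowup π (vanishingIdeal Y)) {J : X.IdealSheafData} {b d : ℕ} (hb : 1 ≤ b) (hbd : b < d)
    {x' : X'} (hY : stalkIdeal (vanishingIdeal Y) (π x') = maximalIdeal (X.presheaf.stalk (π x')))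
    (hW : CuspShape b d (X.presheaf.stalk (π x')) (stalkIdeal J (π x')))
    (hle : (b : ℕ∞) ≤ idealOrder (controlledTransform π (vanishingIdeal Y) J b) x') :
    Function.Surjective (IsLocalRing.ResidueField.map (π.stalkMap x').hom) := by
  classical
  obtain ⟨hreg, hdim, x, y, hxy, u, hu, hJ⟩ := hW
  haveI := hreg
  obtain ⟨m, rfl⟩ : ∃ m, d = b + m := Nat.exists_eq_add_of_le hbd.le
  have hm1 : 1 ≤ m := by omega
  obtain ⟨c, hc_def⟩ : ∃ c : Fin 2 → X.presheaf.stalk (π x'), c = ![x, y] := ⟨_, rfl⟩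
  have hc0 : c 0 = x := by rw [hc_def]; rfl
  have hc1 : c 1 = y := by rw [hc_def]; rfl
  have hc : Ideal.span (Set.range c) = maximalIdeal _ := by rw [hc_def, MohWindow.range_vec2]; exact hxy
  have hcY : Ideal.span (Set.range c) = stalkIdeal (vanishingIdeal Y) (π x') := hc.trans hY.symm
  have hJc : stalkIdeal J (π x') = Ideal.span {c 1 ^ b + u * c 0 ^ (b + m)} := by rw [hJ, hc0, hc1]
  obtain ⟨j, 𝔴, χ, hχ, hloc, h𝔴⟩ := hπ.exists_reesChart_stalk x' c hcY
  letI := χ.toAlgebra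
  haveI : IsLocalization.AtPrime (X'.presheaf.stalk x') 𝔴.asIdeal := hloc
  have halg : ∀ w, (algebraMap (chartRing c j) (X'.presheaf.stalk x') :
      chartRing c j →+* X'.presheaf.stalk x') w = χ w := fun _ => rfl
  obtain ⟨hLreg, ht1, ht2⟩ :=
    MohWindow.chart_isRegularLocalRing_and_not_mem_sq hdim c hc j 𝔴.asIdeal h𝔴 (X'.presheaf.stalk x')
  haveI := hLreg
  haveI := isDomain_of_isRegularLocalRing (X'.presheaf.stalk x')
  obtain ⟨ψ, hψ⟩ : ∃ ψ : X.presheaf.stalk (π x') →+* X'.presheaf.stalk x', ψ = (π.stalkMap x').hom :=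
    ⟨_, rfl⟩
  have hχψ : ∀ a, χ (chartBase c j a) = ψ a := fun a => by rw [hψ]; exact hχ a
  rw [halg, hχψ] at ht1 ht2
  have hrel : ∀ i, ψ (c i) = ψ (c j) * χ (chartGen c j i) := by
    rw [hψ]; exact stalkMap_apply_eq_mul_chartGen j χ hχ
  have ht0 : ψ (c j) ≠ 0 := fun h => ht2 (by rw [h]; exact zero_mem _)
  have hv : IsUnit (ψ u) := hu.map ψ
  have hcYmap : (stalkIdeal (vanishingIdeal Y) (π x')).map ψ = Ideal.span {ψ (c j)} := by
    rw [← hcY, Ideal.map_span_range_eq_span_singleton _ c j _ hrel]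
  have hJ' : ∀ G : X'.presheaf.stalk x', ψ (c 1 ^ b + u * c 0 ^ (b + m)) = ψ (c j) ^ b * G →
      stalkIdeal (controlledTransform π (vanishingIdeal Y) J b) x' = Ideal.span {G} := by
    intro G hG
    have hJmap : (stalkIdeal J (π x')).map ψ = Ideal.span {ψ (c j) ^ b * G} := by
      rw [hJc, Ideal.map_span, Set.image_singleton, hG]
    rw [controlledTransform, stalkIdeal_colon, stalkIdeal_pow, stalkIdeal_comap_eq_map_stalkMap,
      stalkIdeal_comap_eq_map_stalkMap, ← hψ, hcYmap, hJmap]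
    exact colon_span_pow_mul_eq ht0 G b
  have hJ'le : stalkIdeal (controlledTransform π (vanishingIdeal Y) J b) x' ≤
      maximalIdeal (X'.presheaf.stalk x') ^ b := (le_idealOrder_iff _ x' b).mp hle
  have hnotunit : ∀ G : X'.presheaf.stalk x', ψ (c 1 ^ b + u * c 0 ^ (b + m)) = ψ (c j) ^ b * G →
      ¬ IsUnit G := by
    intro G hG hGu
    have h1 : stalkIdeal (controlledTransform π (vanishingIdeal Y) J b) x' = ⊤ := by
      rw [hJ' G hG]; exact Ideal.span_singleton_eq_top.mpr hGu
    have h2 : (⊤ : Ideal (X'.presheaf.stalk x')) ≤ maximalIdeal _ ^ b := h1 ▸ hJ'le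
    have h3 : (1 : X'.presheaf.stalk x') ∈ maximalIdeal _ :=
      Ideal.pow_le_self (by omega) (h2 Submodule.mem_top)
    exact (maximalIdeal.isMaximal _).ne_top ((Ideal.eq_top_iff_one _).mpr h3)
  have hL : ψ (c 1 ^ b + u * c 0 ^ (b + m)) = ψ (c 1) ^ b + ψ u * ψ (c 0) ^ (b + m) := by
    simp only [map_add, map_mul, map_pow]
  -- the local homomorphism instance on `ψ` (transported from the stalk map)
  haveI : IsLocalHom ψ := by rw [hψ]; infer_instance
  obtain rfl | rfl : j = 0 ∨ j = 1 := Fin.exists_fin_two.mp ⟨j, rfl⟩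
  · -- chart `t = x`: `G = ε^b + ψu · t^m`, `ε = χ e₁ ∈ 𝔪_{x′}` (else `G` is a unit), i.e. `x′` is the origin
    have hG : ψ (c 1 ^ b + u * c 0 ^ (b + m)) =
        ψ (c 0) ^ b * (χ (chartGen c 0 1) ^ b + ψ u * ψ (c 0) ^ m) := by
      rewrite [hL, hrel 1]
      ring
    have hε : χ (chartGen c 0 1) ∈ maximalIdeal (X'.presheaf.stalk x') := by
      by_contra hεm
      have hεu : IsUnit (χ (chartGen c 0 1)) := by
        by_contra h
        exact hεm ((IsLocalRing.mem_maximalIdeal _).mpr (mem_nonunits_iff.mpr h))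
      exact hnotunit _ hG
        (isUnit_add_of_mem (hεu.pow b) (Ideal.mul_mem_left _ _ (Ideal.pow_mem_of_mem _ ht1 m hm1)))
    have hw : chartGen c 0 1 ∈ 𝔴.asIdeal := by
      rw [← halg] at hε
      exact (IsLocalization.AtPrime.to_map_mem_maximal_iff _ 𝔴.asIdeal _).mp hε
    have horig : ∀ i : Fin 2, i ≠ 0 → chartGen c 0 i ∈ 𝔴.asIdeal := by
      intro i hi
      obtain rfl : i = 1 := by
        rcases Fin.exists_fin_two.mp ⟨i, rfl⟩ with h | h
        · exact absurd h hi
        · exact h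
      exact hw
    have key := residueField_map_surjective_of_chartOrigin c 0 𝔴.asIdeal h𝔴 horig ψ (fun a => by rw [halg, hχψ])
    subst hψ
    exact key
  · -- chart `t = y`: `G = 1 + ψu · t^m · ε^{b+m}` is a unit — impossible at a singular point
    exfalso
    have hG : ψ (c 1 ^ b + u * c 0 ^ (b + m)) =
        ψ (c 1) ^ b * (1 + ψ u * (ψ (c 1) ^ m * χ (chartGen c 1 0) ^ (b + m))) := by
      rewrite [hL, hrel 0]
      ring
    exact hnotunit _ hG (isUnit_add_of_mem isUnit_one
      (Ideal.mul_mem_left _ _ (Ideal.mul_mem_right _ _ (Ideal.pow_mem_of_mem _ ht1 m hm1))))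

/-- **The singular point over a blown-up closed cusp point is closed.** In the situation of
`residueField_map_stalkMap_surjective_of_le`, if moreover `π` is locally of finite type, `X` is a Jacobson scheme and
`π x′` is a closed point of `X`, then `x′` is a closed point of `X′` (`isClosed_singleton_of_residueFieldMap_surjective`).
[cite: StacksProject, Tag 01TB] -/
theorem isClosed_singleton_of_le [IsLocallyNoetherian X'] [LocallyOfFiniteType π] [JacobsonSpace X]
    {Y : Closeds X} (hπ : IsBlowup π (vanishingIdeal Y)) {J : X.IdealSheafData} {b d : ℕ} (hb : 1 ≤ b)
    (hbd : b < d) {x' : X'} (hcl : IsClosed ({π.base x'} : Set X))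
    (hY : stalkIdeal (vanishingIdeal Y) (π x') = maximalIdeal (X.presheaf.stalk (π x')))
    (hW : CuspShape b d (X.presheaf.stalk (π x')) (stalkIdeal J (π x')))
    (hle : (b : ℕ∞) ≤ idealOrder (controlledTransform π (vanishingIdeal Y) J b) x') :
    IsClosed ({x'} : Set X') :=
  isClosed_singleton_of_residueFieldMap_surjective π hcl
    (residueField_map_stalkMap_surjective_of_le hπ hb hbd hY hW hle)

end Local

end Cusp

end CampaignW46

end Summit.ResolutionOfSingularities.ResolutionOfSingularities.Theorems

end
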